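import Literature.AlgebraicGeometry.Dilatations.AffineDilatation
import Mathlib.AlgebraicGeometry.Morphisms.Flat
import Mathlib.AlgebraicGeometry.Morphisms.OpenImmersion
import HarnessLib

/-!
# Dilatations over a discrete valuation ring: the affine case, as schemes

Topic: `Literature/AlgebraicGeometry/Dilatations`; the scheme-level reading of
`AffineDilatation.lean`. For an `O`-algebra `A`, `ϖ ∈ O` and an ideal `I ⊆ A`, the dilatation
`X' = Spec A[I/ϖ] → X = Spec A` (Mayeux–Richarz–Romagny §2.1; BLR §3.2) is an affine morphism
which is an isomorphism over the generic fibre `Spec A[1/ϖ]`, is flat over `Spec O` when `O` is a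
discrete valuation ring with uniformizer `ϖ`, and has the universal property of MRR §2.3 /
BLR 3.2/1 for morphisms from affine schemes `Spec C` on which `ϖ` is a non-zero-divisor:

* `dilatation.specMap` — the structure morphism `Spec A[I/ϖ] → Spec A`;
* `dilatation.isOpenImmersion_specMap_away`, `dilatation.specMap_away_comp` — the generic fibre
  `Spec A[1/ϖ]` is an open subscheme of `X'` over which `X' → X` restricts to the inclusion of
  the generic fibre of `X` (MRR §2.1, `B[I/b][b⁻¹] = B[b⁻¹]`);
* `dilatation.flat_specMap_comp` — `Spec A[I/ϖ] → Spec O` is flat (BLR 3.2/1);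
* `dilatation.existsUnique_specLift` — **universal property**: for `φ : A → C` with `φ(ϖ)`
  regular and `φ(I) ⊆ ϖC`, there is a unique `Spec C → Spec A[I/ϖ]` over `Spec A`
  (MRR §2.3, Proposition; BLR 3.2/1 (b)).

## References

* A. Mayeux, T. Richarz, M. Romagny, *Néron blowups and low-degree cohomological applications*,
  arXiv:2001.03597 (2020), §2.1, §2.3. [MayeuxRicharzRomagny2020]
* S. Bosch, W. Lütkebohmert, M. Raynaud, *Néron Models*, Springer 1990, Prop. 3.2/1.
  [BLRNeronModels1990] (Not held; numbers only.)
-/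

noncomputable section

open CategoryTheory AlgebraicGeometry IsLocalization

namespace Literature.AlgebraicGeometry.Dilatations

universe u

namespace dilatation

section General

variable {O : Type u} [CommRing O] (ϖ : O) {A : Type u} [CommRing A] [Algebra O A] (I : Ideal A)

/-- The dilatation morphism `Spec A[I/ϖ] → Spec A`. [cite: MayeuxRicharzRomagny2020, §2.1] -/
abbrev specMap : Spec (.of (dilatation ϖ I)) ⟶ Spec (.of A) :=
  Spec.map (CommRingCat.ofHom (algebraMap A (dilatation ϖ I)))

/-- The generic fibre `Spec A[1/ϖ] → Spec A[I/ϖ]` is an open immersion (`A[1/ϖ]` is the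
localization of `A[I/ϖ]` at `ϖ`, MRR §2.1). [cite: MayeuxRicharzRomagny2020, §2.1] -/
theorem isOpenImmersion_specMap_away :
    IsOpenImmersion (Spec.map (CommRingCat.ofHom
      (algebraMap (dilatation ϖ I) (Localization.Away (algebraMap O A ϖ))))) :=
  haveI := isLocalization_away ϖ I
  IsOpenImmersion.of_isLocalization (algebraMap O (dilatation ϖ I) ϖ)

/-- Over the generic fibre the dilatation morphism is the inclusion of the generic fibre of
`Spec A`: `Spec A[1/ϖ] → Spec A[I/ϖ] → Spec A` is `Spec` of `A → A[1/ϖ]`. [cite: MayeuxRicharzRomagny2020, §2.1] -/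
theorem specMap_away_comp :
    Spec.map (CommRingCat.ofHom
        (algebraMap (dilatation ϖ I) (Localization.Away (algebraMap O A ϖ)))) ≫ specMap ϖ I =
      Spec.map (CommRingCat.ofHom (algebraMap A (Localization.Away (algebraMap O A ϖ)))) := by
  have h : CommRingCat.ofHom (algebraMap A (dilatation ϖ I)) ≫
      CommRingCat.ofHom (algebraMap (dilatation ϖ I) (Localization.Away (algebraMap O A ϖ))) =
        CommRingCat.ofHom (algebraMap A (Localization.Away (algebraMap O A ϖ))) := by
    ext x
    simp only [CommRingCat.hom_comp, CommRingCat.hom_ofHom, RingHom.comp_apply]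
    exact (IsScalarTower.algebraMap_apply A (dilatation ϖ I)
      (Localization.Away (algebraMap O A ϖ)) x).symm
  change Spec.map _ ≫ Spec.map _ = _
  rw [← Spec.map_comp, h]

/-- **Universal property of the dilatation, for affine test schemes** (MRR §2.3, Proposition;
BLR Prop. 3.2/1 (b)): for a ring homomorphism `φ : A → C` such that `φ(ϖ)` is a non-zero-divisor
of `C` and `φ(I) ⊆ ϖ C`, there is exactly one morphism `Spec C → Spec A[I/ϖ]` over `Spec A`
(`Spec` is fully faithful; `dilatation.existsUnique_lift`).
[cite: MayeuxRicharzRomagny2020, §2.3 (Proposition, universal property)] -/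
theorem existsUnique_specLift {C : Type u} [CommRing C] (φ : A →+* C)
    (hreg : φ (algebraMap O A ϖ) ∈ nonZeroDivisors C)
    (hI : I.map φ ≤ Ideal.span {φ (algebraMap O A ϖ)}) :
    ∃! t : Spec (.of C) ⟶ Spec (.of (dilatation ϖ I)),
      t ≫ specMap ϖ I = Spec.map (CommRingCat.ofHom φ) := by
  refine ⟨Spec.map (CommRingCat.ofHom (lift φ hreg hI)), ?_, fun t ht => ?_⟩
  · have h : CommRingCat.ofHom (algebraMap A (dilatation ϖ I)) ≫
        CommRingCat.ofHom (lift φ hreg hI) = CommRingCat.ofHom φ := by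
      ext x
      simp only [CommRingCat.hom_comp, CommRingCat.hom_ofHom, RingHom.comp_apply]
      exact lift_algebraMap φ hreg hI x
    change Spec.map _ ≫ Spec.map _ = _
    rw [← Spec.map_comp, h]
  · -- `t = Spec ψ` with `ψ ∘ algebraMap = φ`, and `ψ = lift` by uniqueness
    have h1 : t = Spec.map (CommRingCat.ofHom (Spec.preimage t).hom) := by
      rw [CommRingCat.ofHom_hom, Spec.map_preimage]
    have h2 : CommRingCat.ofHom (algebraMap A (dilatation ϖ I)) ≫ Spec.preimage t =
        CommRingCat.ofHom φ := by
      apply Spec.map_injective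
      rw [Spec.map_comp, Spec.map_preimage]
      exact ht
    have hψ : (Spec.preimage t).hom.comp (algebraMap A (dilatation ϖ I)) = φ :=
      congrArg CommRingCat.Hom.hom h2
    rw [h1, ringHom_ext (φ := φ) hreg hψ (lift_comp_algebraMap φ hreg hI)]

end General

section DVR

variable {O : Type u} [CommRing O] [IsDomain O] [IsDiscreteValuationRing O] {ϖ : O}
  (hϖ : Irreducible ϖ) {A : Type u} [CommRing A] [Algebra O A] (I : Ideal A)

include hϖ in
/-- **The dilatation is flat over the base** (BLR Prop. 3.2/1): `Spec A[I/ϖ] → Spec O` is flat,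
`O` a discrete valuation ring with uniformizer `ϖ` (`dilatation.flat`). [cite: MayeuxRicharzRomagny2020, §2.1] -/
theorem flat_specMap_comp :
    Flat (specMap ϖ I ≫ Spec.map (CommRingCat.ofHom (algebraMap O A))) := by
  rw [← Spec.map_comp, ← CommRingCat.ofHom_comp, HasRingHomProperty.Spec_iff (P := @Flat)]
  change ((algebraMap A (dilatation ϖ I)).comp (algebraMap O A)).Flat
  rw [← IsScalarTower.algebraMap_eq O A (dilatation ϖ I), RingHom.flat_algebraMap_iff]
  exact dilatation.flat hϖ I

end DVR

end dilatation

end Literature.AlgebraicGeometry.Dilatations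

end
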